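import Summits.NavierStokesRegularity.FluidComputer.ClayBlowupRows
import HarnessLib

/-!
# Uniform forced windows along a Clay blow-up, and rigidity of the `L²` pressure gauge

Cell `ns-blowup`, seat `ns-blowup-ecbridge-2` (g5; the E–C endpoint theory seat). LABEL: E–C typing
(KERNEL — no named fact). WHAT THIS IS NOT: not Navier–Stokes evidence — regularity bookkeeping
about the TYPE `ClayBlowup` (no inhabitant is claimed anywhere). Companion memo:
`run/shared/lean/pub/ns-blowup/ecbridge2/ECBRIDGE-2-MEMO-4.md`.

## Content (the two ingredients of the Tao-class re-pressurisation, `ClayBlowupTaoPressure.lean`)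

* `const_eq_zero_of_lintegral_sq_lt_top` — two `L²(ℝ³)` functions differing by a constant are equal
  (`ℝ³` has infinite volume); `pressure_eq_of_eventuallyEq_of_sq_integrable` — hence two classical
  solutions of the same forced system with the same velocity near an interior time `t` and
  square-integrable pressures at `t` have the SAME pressure at `t` (Tao's normalisation, Lemma 4.1 (i),
  read as gauge rigidity: `pressure_sub_apply_zero_eq_of_eventuallyEq` + this);
* `ClayBlowup.exists_uniform_windows` — on a closed sub-slab `[0, T'']` the forced local solutions of
  Tao's theorem (tree theorem F2) from the slices `u(a)`, `a ∈ [0, T'']`, have ONE lifespan `h` (the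
  `H¹` size of the slices is uniform: Tao's class on the sub-slab, fact-free), carry `∂ₜ` and pressure
  bounds of every order, and COINCIDE with the blow-up on their window (W14-free uniqueness under the
  blow-up's sub-slab bound, ecbridge-1's `piece_eq_shift`);
* `ClayBlowup.window_index_bounds` — the index `⌊2t/h − 1/2⌋₊` puts every `t ≥ 0` `h/4`-inside the
  window `[k h/2, k h/2 + h]`.

References: T. Tao, Anal. PDE 6 (2013), Thm. 5.4, Lemma 4.1 (i), Cor. 11.1 [cite: Tao2011, Thm. 5.4 (ii)+(iv)];
H. Sohr (2001), Thm. V.1.5.1 [cite: Sohr2001, Ch. V Thm. 1.5.1].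
-/

noncomputable section

namespace Summit.NavierStokesRegularity.FluidComputer

open Set MeasureTheory Filter Topology Function
open scoped ENNReal ContDiff NNReal
open Literature.Analysis.FluidPDE
open Summit.NavierStokesRegularity.NavierStokesRegularity
open Summit.NavierStokesRegularity.FluidComputer.PalasekTowerClayBridge

/-! ## §1 Rigidity of the `L²` gauge -/

/-- **Two `L²(ℝ³)` functions that differ by a constant are equal**: if `g₁ − g₂ ≡ c` with
`∫ |g₁|², ∫ |g₂|² < ∞` (and `g₁` continuous, for measurability) then `c = 0` — otherwise
`∫ |c|² = |c|² · vol(ℝ³) = ∞ ≤ 4∫|g₁|² + 4∫|g₂|²`. [folklore] -/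
theorem const_eq_zero_of_lintegral_sq_lt_top {g₁ g₂ : EuclideanSpace ℝ (Fin 3) → ℝ} {c : ℝ}
    (hg₁ : Continuous g₁) (h₁ : ∫⁻ x, ‖g₁ x‖ₑ ^ 2 < ⊤) (h₂ : ∫⁻ x, ‖g₂ x‖ₑ ^ 2 < ⊤)
    (hc : ∀ x, g₁ x - g₂ x = c) : c = 0 := by
  by_contra hne
  have hpt : ∀ x : EuclideanSpace ℝ (Fin 3), ‖c‖ₑ ^ 2 ≤ 4 * ‖g₁ x‖ₑ ^ 2 + 4 * ‖g₂ x‖ₑ ^ 2 := by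
    intro x
    rw [← hc x]
    have h1 : ‖g₁ x - g₂ x‖ₑ ≤ 2 * max ‖g₁ x‖ₑ ‖g₂ x‖ₑ :=
      enorm_sub_le.trans (by rw [two_mul]; exact add_le_add (le_max_left _ _) (le_max_right _ _))
    have h2 : max ‖g₁ x‖ₑ ‖g₂ x‖ₑ ^ 2 ≤ ‖g₁ x‖ₑ ^ 2 + ‖g₂ x‖ₑ ^ 2 := by
      rcases le_total ‖g₁ x‖ₑ ‖g₂ x‖ₑ with h | h
      · rw [max_eq_right h]; exact le_add_self
      · rw [max_eq_left h]; exact le_self_add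
    calc ‖g₁ x - g₂ x‖ₑ ^ 2 ≤ (2 * max ‖g₁ x‖ₑ ‖g₂ x‖ₑ) ^ 2 := pow_le_pow_left' h1 2
      _ = 4 * max ‖g₁ x‖ₑ ‖g₂ x‖ₑ ^ 2 := by rw [mul_pow]; norm_num
      _ ≤ 4 * (‖g₁ x‖ₑ ^ 2 + ‖g₂ x‖ₑ ^ 2) := by gcongr
      _ = 4 * ‖g₁ x‖ₑ ^ 2 + 4 * ‖g₂ x‖ₑ ^ 2 := by rw [mul_add]
  have hmeas : Measurable fun x : EuclideanSpace ℝ (Fin 3) => 4 * ‖g₁ x‖ₑ ^ 2 :=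
    (hg₁.measurable.enorm.pow_const 2).const_mul 4
  have hle : ∫⁻ _ : EuclideanSpace ℝ (Fin 3), ‖c‖ₑ ^ 2 ≤
      (4 * ∫⁻ x, ‖g₁ x‖ₑ ^ 2) + 4 * ∫⁻ x, ‖g₂ x‖ₑ ^ 2 := by
    calc ∫⁻ _ : EuclideanSpace ℝ (Fin 3), ‖c‖ₑ ^ 2
        ≤ ∫⁻ x, (4 * ‖g₁ x‖ₑ ^ 2 + 4 * ‖g₂ x‖ₑ ^ 2) := lintegral_mono hpt
      _ = (∫⁻ x : EuclideanSpace ℝ (Fin 3), 4 * ‖g₁ x‖ₑ ^ 2) + ∫⁻ x, 4 * ‖g₂ x‖ₑ ^ 2 :=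
          lintegral_add_left hmeas _
      _ = (4 * ∫⁻ x, ‖g₁ x‖ₑ ^ 2) + 4 * ∫⁻ x, ‖g₂ x‖ₑ ^ 2 := by
          rw [lintegral_const_mul' _ _ (by norm_num), lintegral_const_mul' _ _ (by norm_num)]
  have h4 : (4 : ℝ≥0∞) < ⊤ := by simp
  have hfin : (4 * ∫⁻ x : EuclideanSpace ℝ (Fin 3), ‖g₁ x‖ₑ ^ 2) + 4 * ∫⁻ x, ‖g₂ x‖ₑ ^ 2 < ⊤ :=
    ENNReal.add_lt_top.2 ⟨ENNReal.mul_lt_top h4 h₁, ENNReal.mul_lt_top h4 h₂⟩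
  have htop : ∫⁻ _ : EuclideanSpace ℝ (Fin 3), ‖c‖ₑ ^ 2 = ⊤ := by
    rw [lintegral_const, measure_univ_of_isAddLeftInvariant volume, ENNReal.mul_top]
    exact pow_ne_zero 2 (by simpa using hne)
  exact absurd (hle.trans_lt hfin) (by rw [htop]; exact lt_irrefl _)

/-- `∫ ‖w‖² = ∫ ‖D⁰ w‖²` (vector version). [folklore] -/
private theorem lintegral_enorm_sq_eq_iteratedFDeriv_zero_vec
    (v : EuclideanSpace ℝ (Fin 3) → EuclideanSpace ℝ (Fin 3)) :
    ∫⁻ x, ‖v x‖ₑ ^ 2 = ∫⁻ x, ‖iteratedFDeriv ℝ 0 v x‖ₑ ^ 2 :=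
  lintegral_congr fun x => by rw [← ofReal_norm, ← ofReal_norm, norm_iteratedFDeriv_zero]

/-- **Gauge rigidity for classical solutions with `L²` pressures.** Two classical solutions of the
same forced system whose velocities agree near an interior time `t` of both time sets and whose
pressures at time `t` are square integrable have the SAME pressure at time `t`.
[cite: Tao2011, Lemma 4.1 (i)] -/
theorem pressure_eq_of_eventuallyEq_of_sq_integrable {ν : ℝ} {S₁ S₂ : Set ℝ}
    {f u₁ u₂ : ℝ → EuclideanSpace ℝ (Fin 3) → EuclideanSpace ℝ (Fin 3)}
    {p₁ p₂ : ℝ → EuclideanSpace ℝ (Fin 3) → ℝ}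
    (h₁ : IsClassicalNSSolutionOn S₁ ν f u₁ p₁) (h₂ : IsClassicalNSSolutionOn S₂ ν f u₂ p₂)
    {t : ℝ} (ht₁ : S₁ ∈ 𝓝 t) (ht₂ : S₂ ∈ 𝓝 t) (heq : ∀ᶠ τ in 𝓝 t, u₁ τ = u₂ τ)
    (hL₁ : ∫⁻ x, ‖p₁ t x‖ₑ ^ 2 < ⊤) (hL₂ : ∫⁻ x, ‖p₂ t x‖ₑ ^ 2 < ⊤) : p₁ t = p₂ t := by
  have hgauge : ∀ x, p₁ t x - p₁ t 0 = p₂ t x - p₂ t 0 :=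
    h₁.pressure_sub_apply_zero_eq_of_eventuallyEq h₂ ht₁ ht₂ heq
  have hc : ∀ x, p₁ t x - p₂ t x = p₁ t 0 - p₂ t 0 := fun x => by linarith [hgauge x]
  have hcont : Continuous (p₁ t) := (h₁.contDiff_pressure (mem_of_mem_nhds ht₁)).continuous
  have h0 := const_eq_zero_of_lintegral_sq_lt_top hcont hL₁ hL₂ hc
  funext x
  linarith [hc x]

namespace ClayBlowup

variable {ν : ℝ} (X : ClayBlowup ν)

/-! ## §2 Uniform forced windows on a closed sub-slab, identified with the blow-up -/

/-- **Uniform F2 windows along a closed sub-slab `[0, T'']` of a Clay blow-up** (`ν > 0`, any cap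
`h₀ > 0` on the lifespan): ONE `h ∈ (0, h₀]` such that from EVERY slice `u(a)`, `a ∈ [0, T'']`, the
forced system (force `f(· + a)`) has a classical solution `(w, q)` on `[0, h] × ℝ³` with `w(0) = u(a)`,
`∂ₜw` and `q` bounded in every `H^k` on `[0, h]`, and `w(s) = u(s + a)` as long as `s + a ≤ T''`.
(Tao's forced local existence = tree theorem F2, lifespan from the UNIFORM `H¹` size of the slices —
Tao's class on `[0, T'']`, fact-free — and the `H¹` size of the Clay force; identification by
ecbridge-1's `piece_eq_shift` under the sub-slab sup bound.) [cite: Tao2011, Thm. 5.4 (ii)+(iv)]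
[cite: Sohr2001, Ch. V Thm. 1.5.1] -/
theorem exists_uniform_windows (hν : 0 < ν) {T'' : ℝ} (hT''0 : 0 < T'') (hT'' : T'' < X.T)
    {h₀ : ℝ} (hh₀ : 0 < h₀) :
    ∃ h : ℝ, 0 < h ∧ h ≤ h₀ ∧ ∀ a ∈ Icc 0 T'',
      ∃ (w : ℝ → EuclideanSpace ℝ (Fin 3) → EuclideanSpace ℝ (Fin 3))
        (q : ℝ → EuclideanSpace ℝ (Fin 3) → ℝ),
        IsClassicalNSSolutionOn (Icc 0 h) ν (fun s => X.f (s + a)) w q ∧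
        (∀ n : ℕ, ∃ C : ℝ≥0, ∀ s ∈ Icc 0 h,
          ∫⁻ x, ‖iteratedFDeriv ℝ n (timeDerivWithin (Icc 0 h) w s) x‖ₑ ^ 2 ≤ C) ∧
        (∀ n : ℕ, ∃ C : ℝ≥0, ∀ s ∈ Icc 0 h, ∫⁻ x, ‖iteratedFDeriv ℝ n (q s) x‖ₑ ^ 2 ≤ C) ∧
        ∀ s ∈ Icc 0 h, s + a ≤ T'' → w s = X.u (s + a) := by
  obtain ⟨c, hc, hloc⟩ := tao2011_smooth_local_existence_forced_holds
  obtain ⟨C₀, C₁, B, hB0, -, -, hBf⟩ :=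
    ForcedContinuation.exists_force_slice_bounds X.force_smooth X.force_decay
  have hcl := X.classical_Icc hT''0 hT''
  have hE := X.energy T'' hT''
  obtain ⟨M, hM⟩ := X.exists_norm_le hν hT''
  have hTao := X.hasBoundedSobolevNormsOn hν hT''0 hT''
  obtain ⟨D0, hD0⟩ := hTao 0
  obtain ⟨D1, hD1⟩ := hTao 1
  -- the uniform `H¹` radius
  set A : ℝ := Real.sqrt ((D0 : ℝ) + 3 * D1) with hA
  have hA0 : 0 ≤ A := Real.sqrt_nonneg _
  have hA2 : ENNReal.ofReal (A ^ 2) = (D0 : ℝ≥0∞) + 3 * D1 := by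
    rw [hA, Real.sq_sqrt (by positivity), ENNReal.ofReal_add (by positivity) (by positivity),
      ENNReal.ofReal_coe_nnreal, ENNReal.ofReal_mul (by norm_num), ENNReal.ofReal_coe_nnreal]
    norm_num
  -- the uniform lifespan
  set h : ℝ := min h₀ (min 1 (c * ν ^ 3 / (A + B + 1) ^ 4)) with hh
  have hhh₀ : h ≤ h₀ := min_le_left _ _
  have hh1 : h ≤ 1 := (min_le_right _ _).trans (min_le_left _ _)
  have hhc : h ≤ c * ν ^ 3 / (A + B + 1) ^ 4 := (min_le_right _ _).trans (min_le_right _ _)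
  have hhpos : 0 < h := lt_min hh₀ (lt_min one_pos (by positivity))
  have hsmall : (A + B * h) ^ 4 * h ≤ c * ν ^ 3 := by
    have h1 : A + B * h ≤ A + B + 1 := by nlinarith
    have h2 : 0 ≤ A + B * h := by positivity
    calc (A + B * h) ^ 4 * h ≤ (A + B + 1) ^ 4 * h :=
          mul_le_mul_of_nonneg_right (pow_le_pow_left₀ h2 h1 4) hhpos.le
      _ ≤ (A + B + 1) ^ 4 * (c * ν ^ 3 / (A + B + 1) ^ 4) :=
          mul_le_mul_of_nonneg_left hhc (by positivity)
      _ = c * ν ^ 3 := by field_simp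
  refine ⟨h, hhpos, hhh₀, fun a ha => ?_⟩
  -- the slice `u a`: `H^∞` with `H¹` size `≤ A`
  have hHinf : ∀ m : ℕ, ∫⁻ x, ‖iteratedFDeriv ℝ m (X.u a) x‖ₑ ^ 2 < ⊤ := fun m => by
    obtain ⟨C, hC⟩ := hTao m
    exact (hC a ha).trans_lt ENNReal.coe_lt_top
  have hdat : (∫⁻ x, ‖X.u a x‖ₑ ^ 2) +
      (∫⁻ x, ENNReal.ofReal (frobeniusNormSq (fderiv ℝ (X.u a) x))) ≤ ENNReal.ofReal (A ^ 2) := by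
    rw [hA2]
    refine add_le_add ?_ ?_
    · rw [lintegral_enorm_sq_eq_iteratedFDeriv_zero_vec]; exact hD0 a ha
    · exact (lintegral_frobeniusNormSq_le_three_mul_iteratedFDeriv_one (X.u a)).trans
        (by gcongr; exact hD1 a ha)
  have hfB : ∀ t ∈ Icc 0 h, (∫⁻ x, ‖(fun s => X.f (s + a)) t x‖ₑ ^ 2) +
      (∫⁻ x, ENNReal.ofReal (frobeniusNormSq (fderiv ℝ ((fun s => X.f (s + a)) t) x))) ≤
        ENNReal.ofReal (B ^ 2) := fun t ht => hBf (t + a) (by linarith [ht.1, ha.1])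
  obtain ⟨w, q, hw, hw0, hwS, hwS', hqS, -⟩ := hloc hν hhpos (hcl.contDiff_velocity ha)
    (hcl.divFree a ha) hHinf (X.force_smooth.isSmoothSpaceTimeOn_Icc_timeShift ha.1 h)
    (X.force_decay.hasUniformRapidDecayOn_Icc_timeShift X.force_smooth ha.1 hhpos) hA0 hB0 hdat hfB
    hsmall
  have hEw : ∃ C : ℝ≥0∞, C < ⊤ ∧ ∀ t ∈ Icc 0 h, ∫⁻ x, ‖w t x‖ₑ ^ 2 ≤ C :=
    ClayEvolution.energy_of_hasBoundedSobolevNormsOn hwS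
  refine ⟨w, q, hw, hwS', hqS, fun s hs hsa => ?_⟩
  rcases hs.1.eq_or_lt with h0 | hs0
  · rw [← h0, hw0, zero_add]
  · exact ForcedContinuation.piece_eq_shift hν X.force_smooth X.force_decay hcl hE hM ha.1 hs0
      (by linarith) hs.2 hw hEw hw0 s ⟨hs0.le, le_rfl⟩

/-! ## §3 The re-pressurisation theorem -/

/-- The window index `⌊2t/h − 1/2⌋₊` places `t ≥ 0` inside `[k h/2, k h/2 + 3h/4)`; for `k ≥ 1`
even inside `[k h/2 + h/4, k h/2 + 3h/4)`. [folklore] -/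
theorem window_index_bounds {h : ℝ} (hh : 0 < h) {t : ℝ} (ht : 0 ≤ t) :
    (Nat.floor (2 * t / h - 1 / 2) : ℝ) * (h / 2) ≤ t ∧
      t < (Nat.floor (2 * t / h - 1 / 2) : ℝ) * (h / 2) + 3 * h / 4 ∧
      (1 ≤ Nat.floor (2 * t / h - 1 / 2) →
        (Nat.floor (2 * t / h - 1 / 2) : ℝ) * (h / 2) + h / 4 ≤ t) := by
  set y : ℝ := 2 * t / h - 1 / 2 with hy
  have hty : t = (y + 1 / 2) * (h / 2) := by rw [hy]; field_simp; ring
  have hlt : y < (Nat.floor y : ℝ) + 1 := Nat.lt_floor_add_one y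
  refine ⟨?_, ?_, fun hk => ?_⟩
  · rcases lt_or_ge y 0 with hy0 | hy0
    · have : Nat.floor y = 0 := Nat.floor_eq_zero.2 (by linarith)
      rw [this]; simp [ht]
    · have hfl : (Nat.floor y : ℝ) ≤ y := Nat.floor_le hy0
      rw [hty]; nlinarith
  · rw [hty]; nlinarith
  · have hy1 : (1 : ℝ) ≤ y := by
      by_contra hcon
      have : Nat.floor y = 0 := Nat.floor_eq_zero.2 (by linarith)
      omega
    have hfl : (Nat.floor y : ℝ) ≤ y := Nat.floor_le (by linarith)
    rw [hty]; nlinarith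

end ClayBlowup

end Summit.NavierStokesRegularity.FluidComputer

end
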